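import Summits.QuantumAdvantage.QuantumAdvantage.Theorems.SteerDialCylinder
import Literature.Computability.MetaComplexity.RazborovSmolenskyPoly
import Summits.QuantumAdvantage.QuantumAdvantage.Theorems.RingPeriodFoldStrategies

/-!
# `¬ AdaptiveNoSat3`: body-only rotation-invariant tests defeat every pad/rotation certificate schedule

Negative lemma for the SpreadDial line (item 30909 `AlgCover3`): the schedule-only «adaptive no-saturation» dichotomy
`AdaptiveNoSat3` of the decomposition workshop (lens-5 g9 «TagDial», rev 1/2 hinge; rev 3 records it as refuted) is
FALSE.  Statement inlined verbatim in `steerDial_not_adaptiveNoSat3`.  (decomp-qadv critic row 60/60v3 certificate.)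

Witness family: `n = b·a`, `E = {y : C_n | every class sum Σ_{i ≡ j (mod a)} y_i ≡ 0 (mod 3)}`,
test `ψ(x) = 1 − Π_{j<a} (1 − L_j(x)²)` of degree `2a` on the body coordinates (`L_j` the class sums in `𝔽₃`):
`ψ(x) = 1 ↔ body(x) ∉ E`; `E` is rotation invariant, so `Bad_{T,r,u} ⊇ E` for EVERY schedule; `#E = S(b)^a` with
`|3·S(b) − 2^b| ≤ 2`, hence `2^n/4^a ≤ #E ≤ (2/3)^a·2^n`: dense test (`(2/3)^a < η`) but `#Bad ≥ 2^n/4^a > 2^n/n`.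
-/

set_option linter.dupNamespace false

open Finset
open Literature.Computability.QuantumComplexity Literature.Computability.MetaComplexity
open Literature.Computability.QuantumComplexity.RingHLF
open Summit.QuantumAdvantage.AdviceFreeQNC0
open Summit.QuantumAdvantage.QuantumAdvantage.Theses
open Summit.QuantumAdvantage.QuantumAdvantage.Theorems.SteerDial

namespace Summit.QuantumAdvantage.QuantumAdvantage.Theorems.SteerDial
namespace NoSatCert

/-! ## 1. Residue counts of Hamming weights mod 3 -/
/-- indicator of a bit in `𝔽₃` -/
def bit3 (t : Bool) : ZMod 3 := if t then 1 else 0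
/-- weight of a word mod 3 -/
def wt {b : ℕ} (w : Fin b → Bool) : ZMod 3 := ∑ l, bit3 (w l)
/-- `S b r = #{w ∈ C_b : |w| ≡ r (mod 3)}` -/
def S (b : ℕ) (r : ZMod 3) : ℕ := (univ.filter fun w : Fin b → Bool => wt w = r).card
/-- SteerDial helper `S_eq_sum` (lens-5 g7 SteerDial twin; see the enclosing section docstring). -/
theorem S_eq_sum (b : ℕ) (r : ZMod 3) : S b r = ∑ w : Fin b → Bool, if wt w = r then 1 else 0 := by
  unfold S; rw [Finset.card_filter]
/-- SteerDial helper `wt_cons` (lens-5 g7 SteerDial twin; see the enclosing section docstring). -/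
theorem wt_cons {b : ℕ} (t : Bool) (w : Fin b → Bool) : wt (Fin.cons t w : Fin (b + 1) → Bool) = bit3 t + wt w := by
  unfold wt; rw [Fin.sum_univ_succ]; simp [Fin.cons_zero, Fin.cons_succ]
/-- SteerDial helper `S_succ` (lens-5 g7 SteerDial twin; see the enclosing section docstring). -/
theorem S_succ (b : ℕ) (r : ZMod 3) : S (b + 1) r = S b r + S b (r - 1) := by
  rw [S_eq_sum, S_eq_sum, S_eq_sum]
  rw [← Fintype.sum_equiv (Fin.consEquiv fun _ : Fin (b + 1) => Bool)
        (fun p : Bool × (Fin b → Bool) => if bit3 p.1 + wt p.2 = r then 1 else 0)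
        (fun v => if wt v = r then 1 else 0)
        (by intro p
            change (if bit3 p.1 + wt p.2 = r then 1 else 0) = if wt (Fin.cons p.1 p.2 : Fin (b + 1) → Bool) = r then 1 else 0
            rw [wt_cons])]
  rw [Fintype.sum_prod_type, Fintype.sum_bool]
  have h1 : ∀ w : Fin b → Bool, (bit3 true + wt w = r ↔ wt w = r - 1) := by
    intro w; simp only [bit3, if_true]; constructor <;> intro h
    · rw [← h]; ring
    · rw [h]; ring
  have h0 : ∀ w : Fin b → Bool, (bit3 false + wt w = r ↔ wt w = r) := by
    intro w; simp [bit3]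
  rw [add_comm]
  congr 1
  · exact Finset.sum_congr rfl fun w _ => if_congr (h0 w) rfl rfl
  · exact Finset.sum_congr rfl fun w _ => if_congr (h1 w) rfl rfl
/-- SteerDial helper `S_zero` (lens-5 g7 SteerDial twin; see the enclosing section docstring). -/
theorem S_zero (r : ZMod 3) : S 0 r = if r = 0 then 1 else 0 := by
  rw [S_eq_sum]
  simp [wt]
  by_cases h : r = 0
  · subst h; simp
  · rw [if_neg h]; simp [eq_comm, h]
/-- the cyclic invariant: `3·S(b,·) − 2^b = σ·(2,−1,−1)` up to a cyclic shift, `σ = ±1`. -/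
theorem S_invariant (b : ℕ) : ∃ r₀ : ZMod 3, ∃ σ : ℤ, (σ = 1 ∨ σ = -1) ∧
    ∀ r, 3 * (S b r : ℤ) - 2 ^ b = if r = r₀ then 2 * σ else -σ := by
  induction b with
  | zero =>
    refine ⟨0, 1, Or.inl rfl, fun r => ?_⟩
    rw [S_zero]; by_cases h : r = 0 <;> simp [h]
  | succ b ih =>
    obtain ⟨r₀, σ, hσ, h⟩ := ih
    refine ⟨r₀ + 2, -σ, by rcases hσ with rfl | rfl <;> simp, fun r => ?_⟩
    have e : (3 : ℤ) * (S (b + 1) r : ℤ) - 2 ^ (b + 1) = (3 * (S b r : ℤ) - 2 ^ b) + (3 * (S b (r - 1) : ℤ) - 2 ^ b) := by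
      rw [S_succ]; push_cast; ring
    rw [e, h r, h (r - 1)]
    have key : ∀ (σ' : ℤ), (σ' = 1 ∨ σ' = -1) → ∀ r₁ r' : ZMod 3,
        ((if r' = r₁ then 2 * σ' else -σ') + (if r' - 1 = r₁ then 2 * σ' else -σ') : ℤ)
          = if r' = r₁ + 2 then 2 * -σ' else - -σ' := by
      intro σ' hσ' r₁ r'
      rcases hσ' with rfl | rfl <;> revert r₁ r' <;> decide
    exact key σ hσ r₀ r
/-- SteerDial helper `S_bounds` (lens-5 g7 SteerDial twin; see the enclosing section docstring). -/
theorem S_bounds (b : ℕ) (r : ZMod 3) : (2 : ℤ) ^ b - 2 ≤ 3 * (S b r : ℤ) ∧ 3 * (S b r : ℤ) ≤ 2 ^ b + 2 := by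
  obtain ⟨r₀, σ, hσ, h⟩ := S_invariant b
  have := h r
  by_cases hr : r = r₀
  · rw [if_pos hr] at this
    rcases hσ with rfl | rfl <;> constructor <;> linarith
  · rw [if_neg hr] at this
    rcases hσ with rfl | rfl <;> constructor <;> linarith

/-! ## 2. The sub-lattice `E ⊆ C_{b·a}`: class sums mod 3, rotation invariance, cardinality -/

section Lattice
variable {a b : ℕ}
/-- position of the `l`-th member of residue class `j` (positions `≡ j (mod a)`): `j + a·l`. -/
def idx (a b : ℕ) (l : Fin b) (j : Fin a) : Fin (b * a) := finProdFinEquiv (l, j)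
/-- SteerDial helper `idx_val` (lens-5 g7 SteerDial twin; see the enclosing section docstring). -/
theorem idx_val (l : Fin b) (j : Fin a) : (idx a b l j).val = j.val + a * l.val := by simp [idx]
/-- class sum `L_j(y) = Σ_l y_{j + a l} ∈ 𝔽₃` -/
def L (a b : ℕ) (y : Fin (b * a) → Bool) (j : Fin a) : ZMod 3 := ∑ l : Fin b, bit3 (y (idx a b l j))
/-- the sub-lattice `E`: all class sums vanish mod 3 -/
def Eset (a b : ℕ) : Finset (Fin (b * a) → Bool) := univ.filter fun y => ∀ j, L a b y j = 0
/-- SteerDial helper `rot_succ'` (lens-5 g7 SteerDial twin; see the enclosing section docstring). -/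
theorem rot_succ' {n : ℕ} (k : ℕ) (y : Fin n → Bool) : rot (k + 1) y = rot 1 (rot k y) := by
  funext i; simp only [rot]; congr 1; apply Fin.ext; simp only
  rw [Nat.mod_add_mod]; congr 1; omega
/-- rotating by one moves class `j+1` onto class `j` … -/
theorem L_rot_one_lt (y : Fin (b * a) → Bool) (j : Fin a) (hj : j.val + 1 < a) :
    L a b (rot 1 y) j = L a b y ⟨j.val + 1, hj⟩ := by
  unfold L; refine Finset.sum_congr rfl fun l _ => ?_
  simp only [rot]; congr 2; apply Fin.ext; simp only [idx_val]
  have h1 : a * (l.val + 1) ≤ a * b := Nat.mul_le_mul_left _ l.isLt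
  have h2 : j.val + a * l.val + 1 < b * a := by
    rw [Nat.mul_succ] at h1; rw [Nat.mul_comm b a]; generalize a * l.val = q at *; generalize a * b = s at *; omega
  rw [Nat.mod_eq_of_lt h2]; omega
/-- … and class `0` (cyclically re-indexed) onto class `a−1`. -/
theorem L_rot_one_top (y : Fin (b * a) → Bool) (j : Fin a) (hj : j.val + 1 = a) :
    L a b (rot 1 y) j = L a b y ⟨0, j.pos⟩ := by
  unfold L
  -- re-index the right-hand side by the cyclic shift of `Fin b`
  rw [← (Function.Injective.bijective_of_finite (RingSymmetry.shift_injective (n := b) 1)).sum_comp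
        (fun l => bit3 (y (idx a b l ⟨0, j.pos⟩)))]
  refine Finset.sum_congr rfl fun l _ => ?_
  simp only [rot]; congr 2; apply Fin.ext; simp only [idx_val, RingSymmetry.shift]
  have e1 : j.val + a * l.val + 1 = a * (l.val + 1) := by rw [Nat.mul_succ]; omega
  rw [e1, Nat.mul_comm b a, Nat.mul_mod_mul_left]; simp
/-- SteerDial helper `inE_rot_one` (lens-5 g7 SteerDial twin; see the enclosing section docstring). -/
theorem inE_rot_one {y : Fin (b * a) → Bool} (h : (∀ j, L a b y j = 0)) : (∀ j, L a b (rot 1 y) j = 0) := by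
  intro j
  by_cases hj : j.val + 1 < a
  · rw [L_rot_one_lt y j hj]; exact h _
  · have hj' : j.val + 1 = a := by have := j.isLt; omega
    rw [L_rot_one_top y j hj']; exact h _
/-- SteerDial helper `inE_rot` (lens-5 g7 SteerDial twin; see the enclosing section docstring). -/
theorem inE_rot {y : Fin (b * a) → Bool} (h : (∀ j, L a b y j = 0)) (k : ℕ) : (∀ j, L a b (rot k y) j = 0) := by
  induction k with
  | zero => rwa [Summit.QuantumAdvantage.QuantumAdvantage.Theorems.RingPeriodFold.rot_zero]
  | succ k ih => rw [rot_succ']; exact inE_rot_one ih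
/-- split `C_{b·a}` into the `a` residue classes -/
def Φ (a b : ℕ) : (Fin (b * a) → Bool) ≃ (Fin a → Fin b → Bool) where
  toFun y j l := y (idx a b l j)
  invFun z i := z (finProdFinEquiv.symm i).2 (finProdFinEquiv.symm i).1
  left_inv y := by funext i; exact congrArg y (finProdFinEquiv.apply_symm_apply i)
  right_inv z := by funext j l; simp [idx]
/-- SteerDial helper `card_Eset` (lens-5 g7 SteerDial twin; see the enclosing section docstring). -/
theorem card_Eset (a b : ℕ) : (Eset a b).card = (S b 0) ^ a := by
  have h := Finset.card_equiv (Φ a b) (s := Eset a b)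
    (t := Fintype.piFinset fun _ : Fin a => (univ.filter fun w : Fin b → Bool => wt w = 0)) (by
      intro y
      simp only [Eset, Finset.mem_filter, Finset.mem_univ, true_and, Fintype.mem_piFinset]
      rfl)
  rw [h, Fintype.card_piFinset, Finset.prod_const, Finset.card_univ, Fintype.card_fin]
  rfl

end Lattice

/-! ## 3. The test `ψ = 1 − Π_j (1 − L_j²)` on `C_{b·a+m}`: value, degree, count -/

section Test
variable {a b m : ℕ}
/-- body of a padded input: the first `b·a` coordinates -/
def body (m : ℕ) (x : Fin (b * a + m) → Bool) : Fin (b * a) → Bool := fun i => x (Fin.castAdd m i)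
/-- SteerDial helper `body_pad` (lens-5 g7 SteerDial twin; see the enclosing section docstring). -/
theorem body_pad (w : Fin m → Bool) (y : Fin (b * a) → Bool) : body m (pad w y) = y := by
  funext i; simp [body, pad, Fin.append_left]
/-- the test: `ψ(x) = 1 − Π_j (1 − L_j(body x)²)` -/
def psi (a b m : ℕ) : Smolensky.CubeFn (ZMod 3) (b * a + m) :=
  fun x => 1 - ∏ j : Fin a, (1 - (L a b (body m x) j) ^ 2)
/-- SteerDial helper `one_sub_sq` (lens-5 g7 SteerDial twin; see the enclosing section docstring). -/
theorem one_sub_sq (z : ZMod 3) : 1 - z ^ 2 = if z = 0 then 1 else 0 := by revert z; decide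
/-- SteerDial helper `psi_eq` (lens-5 g7 SteerDial twin; see the enclosing section docstring). -/
theorem psi_eq (x : Fin (b * a + m) → Bool) : psi a b m x = if (∀ j, L a b (body m x) j = 0) then 0 else 1 := by
  unfold psi
  simp only [one_sub_sq]
  rw [Finset.prod_boole]
  by_cases h : (∀ j, L a b (body m x) j = 0)
  · rw [if_pos h, if_pos (fun j _ => h j)]; decide
  · rw [if_neg h, if_neg (fun h' => h (fun j => h' j (Finset.mem_univ j)))]; decide
/-- SteerDial helper `psi_eq_one_iff` (lens-5 g7 SteerDial twin; see the enclosing section docstring). -/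
theorem psi_eq_one_iff (x : Fin (b * a + m) → Bool) : psi a b m x = 1 ↔ ¬ (∀ j, L a b (body m x) j = 0) := by
  rw [psi_eq]; by_cases h : (∀ j, L a b (body m x) j = 0) <;> simp [h]
/-- SteerDial helper `psi_ne_one_iff` (lens-5 g7 SteerDial twin; see the enclosing section docstring). -/
theorem psi_ne_one_iff (x : Fin (b * a + m) → Bool) : psi a b m x ≠ 1 ↔ (∀ j, L a b (body m x) j = 0) := by
  rw [Ne, psi_eq_one_iff, not_not]
/-- graded products stay low degree -/
theorem prod_mem_lowDeg {N d : ℕ} {ι' : Type*} (s : Finset ι') (f : ι' → Smolensky.CubeFn (ZMod 3) N)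
    (h : ∀ j ∈ s, f j ∈ Smolensky.lowDeg (ZMod 3) N d) :
    (∏ j ∈ s, f j) ∈ Smolensky.lowDeg (ZMod 3) N (s.card * d) := by
  classical
  induction s using Finset.induction_on with
  | empty =>
    simp only [Finset.prod_empty, Finset.card_empty, zero_mul]
    rw [← Smolensky.mono_empty]; exact Smolensky.mono_mem_lowDeg (by simp)
  | insert j s hj ih =>
    rw [Finset.prod_insert hj, Finset.card_insert_of_notMem hj]
    have h1 := h j (Finset.mem_insert_self j s)
    have h2 := ih (fun i hi => h i (Finset.mem_insert_of_mem hi))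
    have := Smolensky.mul_mem_lowDeg_add h1 h2
    exact Smolensky.lowDeg_mono (by rw [Nat.succ_mul]; omega) this
/-- the class sum as a cube function -/
def Lfn (a b m : ℕ) (j : Fin a) : Smolensky.CubeFn (ZMod 3) (b * a + m) := fun x => L a b (body m x) j
/-- … is linear -/
theorem Lfn_mem_lowDeg (j : Fin a) : Lfn a b m j ∈ Smolensky.lowDeg (ZMod 3) (b * a + m) 1 := by
  have e : Lfn a b m j
      = ∑ l : Fin b, Smolensky.mono (ZMod 3) ({Fin.castAdd m (idx a b l j)} : Finset (Fin (b * a + m))) := by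
    funext x
    simp only [Lfn, L, body, Finset.sum_apply, Smolensky.mono, bit3, Finset.prod_singleton]
    exact Finset.sum_congr rfl fun l _ => by congr 1
  rw [e]
  exact Submodule.sum_mem _ fun l _ => Smolensky.mono_mem_lowDeg (by simp)
/-- SteerDial helper `psi_eq_prod` (lens-5 g7 SteerDial twin; see the enclosing section docstring). -/
theorem psi_eq_prod : psi a b m = 1 - ∏ j : Fin a, (1 - Lfn a b m j * Lfn a b m j) := by
  funext x
  simp only [psi, Lfn, Pi.sub_apply, Pi.one_apply, Finset.prod_apply, Pi.mul_apply, pow_two]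
/-- SteerDial helper `psi_mem_lowDeg` (lens-5 g7 SteerDial twin; see the enclosing section docstring). -/
theorem psi_mem_lowDeg : psi a b m ∈ Smolensky.lowDeg (ZMod 3) (b * a + m) (a * 2) := by
  rw [psi_eq_prod]
  have hg : ∀ j : Fin a, (1 - Lfn a b m j * Lfn a b m j) ∈ Smolensky.lowDeg (ZMod 3) (b * a + m) 2 := by
    intro j
    have h2 := Smolensky.mul_mem_lowDeg_add (Lfn_mem_lowDeg (a := a) (b := b) (m := m) j)
      (Lfn_mem_lowDeg (a := a) (b := b) (m := m) j)
    exact Submodule.sub_mem _ (Smolensky.one_mem_lowDeg _) h2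
  have hp := prod_mem_lowDeg (Finset.univ : Finset (Fin a)) (fun j => 1 - Lfn a b m j * Lfn a b m j)
    (fun j _ => hg j)
  rw [Finset.card_univ, Fintype.card_fin] at hp
  exact Submodule.sub_mem _ (Smolensky.one_mem_lowDeg _) hp

/-- split off the padding window -/
def Ψ (a b m : ℕ) : (Fin (b * a + m) → Bool) ≃ (Fin (b * a) → Bool) × (Fin m → Bool) where
  toFun x := (body m x, fun k => x (Fin.natAdd (b * a) k))
  invFun p := Fin.append p.1 p.2
  left_inv x := Fin.append_castAdd_natAdd
  right_inv p := by
    ext k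
    · simp [body, Fin.append_left]
    · simp [Fin.append_right]

/-- SteerDial helper `card_body_inE` (lens-5 g7 SteerDial twin; see the enclosing section docstring). -/
theorem card_body_inE :
    (univ.filter fun x : Fin (b * a + m) → Bool => (∀ j, L a b (body m x) j = 0)).card = (Eset a b).card * 2 ^ m := by
  rw [Finset.card_filter, Eset, Finset.card_filter]
  rw [Fintype.sum_equiv (Ψ a b m) (fun x => if (∀ j, L a b (body m x) j = 0) then 1 else 0)
        (fun p => if (∀ j, L a b p.1 j = 0) then 1 else 0) (fun x => rfl)]
  rw [Fintype.sum_prod_type, Finset.sum_mul]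
  refine Finset.sum_congr rfl fun y _ => ?_
  by_cases h : (∀ j, L a b y j = 0) <;> simp [h]

/-- SteerDial helper `card_psi_one` (lens-5 g7 SteerDial twin; see the enclosing section docstring). -/
theorem card_psi_one :
    ((univ.filter fun x : Fin (b * a + m) → Bool => psi a b m x = 1).card : ℝ)
      = 2 ^ (b * a + m) - (Eset a b).card * 2 ^ m := by
  have h := Finset.card_filter_add_card_filter_not
    (s := (univ : Finset (Fin (b * a + m) → Bool))) (fun x => psi a b m x = 1)
  have h2 : (univ.filter fun x : Fin (b * a + m) → Bool => ¬ psi a b m x = 1)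
      = univ.filter fun x : Fin (b * a + m) → Bool => (∀ j, L a b (body m x) j = 0) :=
    Finset.filter_congr fun x _ => psi_ne_one_iff x
  rw [h2, card_body_inE, Finset.card_univ, Fintype.card_fun, Fintype.card_bool, Fintype.card_fin] at h
  have h' : ((univ.filter fun x : Fin (b * a + m) → Bool => psi a b m x = 1).card : ℝ)
      + ((Eset a b).card * 2 ^ m : ℕ) = ((2 ^ (b * a + m) : ℕ) : ℝ) := by exact_mod_cast h
  push_cast at h'
  linarith

end Test

/-! ## 4. Assembly: the schedule-independent lower bound kills `AdaptiveNoSat3` -/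


/-- lower bound: `4·S(b,0) ≥ 2^b` once `b ≥ 3` -/
theorem four_S_ge (b : ℕ) (hb : 3 ≤ b) : 2 ^ b ≤ 4 * S b 0 := by
  have h := (S_bounds b 0).1
  have h8 : (8 : ℤ) ≤ 2 ^ b := by
    have : (2 : ℤ) ^ 3 ≤ 2 ^ b := pow_le_pow_right₀ (by norm_num) hb
    norm_num at this; exact this
  have : (2 : ℤ) ^ b ≤ 4 * (S b 0 : ℤ) := by linarith
  exact_mod_cast this

/-- upper bound: `3·S(b,0) ≤ 2^(b+1)` once `b ≥ 1` -/
theorem three_S_le (b : ℕ) (hb : 1 ≤ b) : 3 * S b 0 ≤ 2 ^ (b + 1) := by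
  have h := (S_bounds b 0).2
  have h2 : (2 : ℤ) ≤ 2 ^ b := by
    have : (2 : ℤ) ^ 1 ≤ 2 ^ b := pow_le_pow_right₀ (by norm_num) hb
    simpa using this
  have : 3 * (S b 0 : ℤ) ≤ 2 ^ (b + 1) := by rw [pow_succ]; linarith
  exact_mod_cast this

/-- `#E ≥ 2^{ab} / 4^a` in the form `2^{b a} ≤ 4^a · #E` -/
theorem card_Eset_lower (a b : ℕ) (hb : 3 ≤ b) : 2 ^ (b * a) ≤ 4 ^ a * (Eset a b).card := by
  rw [card_Eset, ← mul_pow, pow_mul]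
  exact Nat.pow_le_pow_left (four_S_ge b hb) a

/-- `#E ≤ (2/3)^a · 2^{b a}` -/
theorem card_Eset_upper (a b : ℕ) (hb : 1 ≤ b) :
    ((Eset a b).card : ℝ) ≤ (2 / 3 : ℝ) ^ a * 2 ^ (b * a) := by
  rw [card_Eset, pow_mul, ← mul_pow]
  push_cast
  refine pow_le_pow_left₀ (by positivity) ?_ a
  have h := three_S_le b hb
  have h' : (3 : ℝ) * (S b 0 : ℝ) ≤ 2 ^ (b + 1) := by exact_mod_cast h
  rw [pow_succ] at h'
  linarith

end NoSatCert

open NoSatCert in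
/-- **`AdaptiveNoSat3` is false**: for every `η > 0` the body-only test `ψ = 1 − Π_{j<a}(1 − L_j²)` (`(2/3)^a < η`,
`n = b·a`, `k' = c = 1`) is dense and of degree `≤ log₂(n+m)`, yet its Bad set contains the rotation-invariant
sub-lattice `E` (`#E ≥ 2ⁿ/4^a > 2ⁿ/n`) whatever the certified schedule. [critic certificate, decomp-qadv row 60v3] -/
theorem steerDial_not_adaptiveNoSat3 : ¬ (
    ∃ η : ℝ, 0 < η ∧ ∀ k' : ℕ, ∃ m : ℕ, 1 ≤ m ∧ ∃ c₁ : ℕ, ∀ c : ℕ, ∃ n₀ : ℕ, ∀ n ≥ n₀,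
      ∀ ψ : Smolensky.CubeFn (ZMod 3) (n + m), ψ ∈ Smolensky.lowDeg (ZMod 3) (n + m) ((Nat.log 2 (n + m)) ^ c) →
        (1 - η) * (2 : ℝ) ^ (n + m) ≤ ((univ.filter fun x : Fin (n + m) → Bool => ψ x = 1).card : ℝ) →
          ∃ T : ℕ, T ≤ (Nat.log 2 n) ^ c₁ ∧ ∃ r : Fin T → ℕ, ∃ u α β : Fin T → Fin m → Bool, ∃ a b : Fin T → Bool,
            (∀ t, wordCert (u t) (α t) (β t) (a t) (b t) = true) ∧
              ((univ.filter fun y : Fin n → Bool => ∀ t : Fin T, ψ (pad (u t) (rot (r t) y)) ≠ 1).card : ℝ) ≤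
                1 / (n : ℝ) ^ k' * (2 : ℝ) ^ n) := by
  rintro ⟨η, hη, H⟩
  obtain ⟨m, -, c₁, H⟩ := H 1
  obtain ⟨n₀, H⟩ := H 1
  -- the number of residue classes: (2/3)^a < η
  obtain ⟨a', ha'⟩ := exists_pow_lt_of_lt_one hη (by norm_num : (2 / 3 : ℝ) < 1)
  set a := a' + 1 with ha_def
  have ha : (2 / 3 : ℝ) ^ a < η :=
    lt_of_le_of_lt (pow_le_pow_of_le_one (by norm_num) (by norm_num) (Nat.le_succ a')) ha'
  have ha1 : 1 ≤ a := Nat.succ_le_succ (Nat.zero_le _)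
  -- the class length
  set b := max n₀ (4 ^ a + 3) with hb_def
  have hb0 : n₀ ≤ b := le_max_left _ _
  have hb4 : 4 ^ a + 3 ≤ b := le_max_right _ _
  have hb3 : 3 ≤ b := le_trans (Nat.le_add_left 3 (4 ^ a)) hb4
  have hb1 : 1 ≤ b := le_trans (by norm_num) hb3
  have hn : n₀ ≤ b * a := le_trans hb0 (Nat.le_mul_of_pos_right _ ha1)
  have hnb : b ≤ b * a := Nat.le_mul_of_pos_right _ ha1
  -- degree of the test
  have hdeg : psi a b m ∈ Smolensky.lowDeg (ZMod 3) (b * a + m) ((Nat.log 2 (b * a + m)) ^ 1) := by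
    refine Smolensky.lowDeg_mono ?_ psi_mem_lowDeg
    rw [pow_one]
    apply Nat.le_log_of_pow_le (by norm_num)
    calc 2 ^ (a * 2) = 4 ^ a := by rw [mul_comm, pow_mul]; norm_num
      _ ≤ b := by omega
      _ ≤ b * a + m := le_trans hnb (Nat.le_add_right _ _)
  -- density of the test
  have hdens : (1 - η) * (2 : ℝ) ^ (b * a + m)
      ≤ ((univ.filter fun x : Fin (b * a + m) → Bool => psi a b m x = 1).card : ℝ) := by
    rw [card_psi_one]
    have hE := card_Eset_upper a b hb1
    have h2m : (0 : ℝ) ≤ 2 ^ m := by positivity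
    have h2n : (0 : ℝ) ≤ 2 ^ (b * a) := by positivity
    have : ((Eset a b).card : ℝ) * 2 ^ m ≤ η * 2 ^ (b * a + m) := by
      rw [pow_add]
      calc ((Eset a b).card : ℝ) * 2 ^ m ≤ ((2 / 3 : ℝ) ^ a * 2 ^ (b * a)) * 2 ^ m :=
            mul_le_mul_of_nonneg_right hE h2m
        _ ≤ (η * 2 ^ (b * a)) * 2 ^ m :=
            mul_le_mul_of_nonneg_right (mul_le_mul_of_nonneg_right ha.le h2n) h2m
        _ = η * (2 ^ (b * a) * 2 ^ m) := by ring
    linarith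
  obtain ⟨T, -, r, u, α, β, aa, bb, -, hbad⟩ := H (b * a) hn (psi a b m) hdeg hdens
  -- every schedule's Bad set contains E
  have hsub : Eset a b ⊆ univ.filter fun y : Fin (b * a) → Bool =>
      ∀ t : Fin T, psi a b m (pad (u t) (rot (r t) y)) ≠ 1 := by
    intro y hy
    rw [Finset.mem_filter]
    refine ⟨Finset.mem_univ _, fun t => ?_⟩
    rw [psi_ne_one_iff, body_pad]
    exact inE_rot (Finset.mem_filter.1 hy).2 _
  have hle : ((Eset a b).card : ℝ) ≤ ((univ.filter fun y : Fin (b * a) → Bool =>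
      ∀ t : Fin T, psi a b m (pad (u t) (rot (r t) y)) ≠ 1).card : ℝ) := by
    exact_mod_cast Finset.card_le_card hsub
  -- … but #E ≥ 2^n / 4^a > 2^n / n
  have hlow : ((2 : ℝ) ^ (b * a)) ≤ (4 : ℝ) ^ a * ((Eset a b).card : ℝ) := by
    exact_mod_cast card_Eset_lower a b hb3
  have hnpos : (0 : ℝ) < ((b * a : ℕ) : ℝ) := by
    have : 0 < b * a := lt_of_lt_of_le (by omega) hnb
    exact_mod_cast this
  have hbad' : ((univ.filter fun y : Fin (b * a) → Bool =>
      ∀ t : Fin T, psi a b m (pad (u t) (rot (r t) y)) ≠ 1).card : ℝ) ≤ 2 ^ (b * a) / ((b * a : ℕ) : ℝ) := by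
    rw [pow_one] at hbad
    calc _ ≤ 1 / ((b * a : ℕ) : ℝ) * 2 ^ (b * a) := hbad
      _ = 2 ^ (b * a) / ((b * a : ℕ) : ℝ) := by ring
  have h4 : ((b * a : ℕ) : ℝ) ≤ (4 : ℝ) ^ a := by
    have key : (2 : ℝ) ^ (b * a) ≤ (4 : ℝ) ^ a * (2 ^ (b * a) / ((b * a : ℕ) : ℝ)) :=
      le_trans hlow (mul_le_mul_of_nonneg_left (le_trans hle hbad') (by positivity))
    rw [mul_div_assoc', le_div_iff₀ hnpos] at key
    have h2 : (0 : ℝ) < 2 ^ (b * a) := by positivity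
    nlinarith
  have h4' : b * a ≤ 4 ^ a := by exact_mod_cast h4
  omega


end Summit.QuantumAdvantage.QuantumAdvantage.Theorems.SteerDial
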